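/-
Origin: expansion seat `planner-pub-hodgecm-pv06-g4-0`, handover #2 2026-08-18T08:22:14Z (`HOME/pub-hodgecm-pv06-g4/lean/Pv06g4/InfiniteAdeleComplex.lean`, md5 91459920, 178 lines);
landed by the gen-7 packager in gate run 26 as `HodgeCM/PerL34/InfiniteAdeleComplex.lean` (verbatim).
-/
/-
Copyright: pub-hodgecm formalisation cell (harness21, 2026). New file (not vendored).
Origin: seat pub-hodgecm-pv06-g4 (WIP module `Pv06g4.InfiniteAdeleComplex`); intended final place
`HodgeCM/PerL34/InfiniteAdeleComplex.lean` (packager renames; no `HodgeCM.*` import is seat-local).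
-/
import Literature.NumberTheory.Automorphic.GaloisActionAdeleRing
import Mathlib.NumberTheory.NumberField.CMField
import Mathlib.NumberTheory.NumberField.InfiniteAdeleRing

/-!
# The infinite adele ring of a CM field is `ℂ^{places}`

KERNEL, hypothesis-free.  For a totally complex number field `L` (in particular a CM field) every infinite
place `w` is complex, so Mathlib's `ringEquivComplexOfIsComplex` (the continuous extension of `w.embedding`)
identifies `L_w` with `ℂ`; assembled over the places this is the bicontinuous ring isomorphism

* `piComplex L : InfiniteAdeleRing L ≃+* (InfinitePlace L → ℂ)`, `(x_w)_w ↦ (ι_w x_w)_w`,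

with `piComplex L (x)_∞ = (w.embedding x)_w` for `x ∈ L` (`piComplex_algebraMap`).  For a CM field `L` with
complex conjugation `c = IsCMField.complexConj L ∈ Gal(L/L⁺)` acting on `L_∞` through the vendored Galois
action (`Literature.NumberTheory.Automorphic.instMulSemiringActionInfiniteAdeleRing`, `(σ x)_w = σ_w (x_{σ⁻¹ w})`):

* `complexConj_smul_infinitePlace : c • w = w` (every infinite place of a CM field is `c`-stable);
* `piComplex_complexConj_smul : piComplex L (c • x) w = conj (piComplex L x w)` — under the dictionary,
  `c ⊗ id` on `L ⊗_{L⁺} (L⁺ ⊗ ℝ) = L_∞` is coordinatewise complex conjugation on `ℂ^{places}`.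

This is the archimedean half of the D3 dictionary `U(H)(𝔸_{L⁺}) ≅ U(H)_∞ × U(H)(𝔸_{L⁺,f})` used for node
N23c (`HodgeCM.PerL34.AdelicUnitaryFactorisation`): it turns the archimedean component of the adelic unitary
relation `(c g)ᵀ H g = H` into the family of matrix relations `g_wᴴ H^{w} g_w = H^{w}` of
`HodgeCM.Literature.RealApproximation.unitaryPiSubmonoid`.

References: [cite: CasselsFrohlichANT1967, Ch. II §§10–11 (completions at complex places), Ch. VII §1.1].
-/

set_option autoImplicit false

noncomputable section

open NumberField NumberField.InfinitePlace NumberField.InfinitePlace.Completion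
open Literature.NumberTheory.Automorphic
open scoped ComplexConjugate

namespace HodgeCM.PerL34.InfiniteAdeleComplex

/-! ## §1 Totally complex fields: `L_∞ ≃+* ℂ^{places}` -/

section TotallyComplex

variable (L : Type*) [Field L] [IsTotallyComplex L]

/-- The coordinate isomorphism `L_w ≃+* ℂ` at a (necessarily complex) infinite place. -/
def placeEquiv (w : InfinitePlace L) : w.Completion ≃+* ℂ :=
  ringEquivComplexOfIsComplex (IsTotallyComplex.isComplex w)

/-- (Ported verbatim from the HodgeCMPerL package; no docstring in the source.) -/
@[simp] theorem placeEquiv_apply (w : InfinitePlace L) (y : w.Completion) :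
    placeEquiv L w y = extensionEmbedding w y := rfl

/-- (Ported verbatim from the HodgeCMPerL package; no docstring in the source.) -/
theorem continuous_placeEquiv (w : InfinitePlace L) : Continuous (placeEquiv L w) :=
  (isometry_extensionEmbedding w).continuous

/-- (Ported verbatim from the HodgeCMPerL package; no docstring in the source.) -/
theorem continuous_placeEquiv_symm (w : InfinitePlace L) : Continuous (placeEquiv L w).symm :=
  (isometryEquivComplexOfIsComplex (IsTotallyComplex.isComplex w)).symm.continuous

/-- The value on principal elements: `ι_w ((x)_w) = w.embedding x`. -/
theorem placeEquiv_coe (w : InfinitePlace L) (x : L) :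
    placeEquiv L w (x : w.Completion) = w.embedding x := by
  rw [placeEquiv_apply]
  exact extensionEmbedding_coe w (WithAbs.toAbs w.1 x)

/-- **`L_∞ ≃+* ℂ^{places}`** for a totally complex `L`: the product of the coordinate isomorphisms. -/
def piComplex : InfiniteAdeleRing L ≃+* (InfinitePlace L → ℂ) :=
  RingEquiv.piCongrRight fun w => placeEquiv L w

/-- (Ported verbatim from the HodgeCMPerL package; no docstring in the source.) -/
@[simp] theorem piComplex_apply (x : InfiniteAdeleRing L) (w : InfinitePlace L) :
    piComplex L x w = extensionEmbedding w (x w) := rfl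

/-- (Ported verbatim from the HodgeCMPerL package; no docstring in the source.) -/
theorem piComplex_symm_apply (y : InfinitePlace L → ℂ) (w : InfinitePlace L) :
    (piComplex L).symm y w = (placeEquiv L w).symm (y w) := rfl

/-- `piComplex` is continuous. -/
theorem continuous_piComplex : Continuous (piComplex L) :=
  continuous_pi fun w => (continuous_placeEquiv L w).comp (continuous_apply w)

/-- `piComplex⁻¹` is continuous. -/
theorem continuous_piComplex_symm : Continuous (piComplex L).symm :=
  continuous_pi fun w => (continuous_placeEquiv_symm L w).comp (continuous_apply w)

/-- `piComplex` as a homeomorphism. -/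
def piComplexHomeomorph : InfiniteAdeleRing L ≃ₜ (InfinitePlace L → ℂ) where
  toEquiv := (piComplex L).toEquiv
  continuous_toFun := continuous_piComplex L
  continuous_invFun := continuous_piComplex_symm L

/-- (Ported verbatim from the HodgeCMPerL package; no docstring in the source.) -/
@[simp] theorem coe_piComplexHomeomorph : ⇑(piComplexHomeomorph L) = piComplex L := rfl

/-- **Principal elements go to embedding families**: `piComplex ((x)_∞) = (w.embedding x)_w`. -/
theorem piComplex_algebraMap (x : L) (w : InfinitePlace L) :
    piComplex L (algebraMap L (InfiniteAdeleRing L) x) w = w.embedding x := by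
  rw [piComplex_apply, InfiniteAdeleRing.algebraMap_apply]
  exact placeEquiv_coe L w x

/-- The coordinate ring homomorphism `L_∞ →+* ℂ` at `w` (evaluation after `piComplex`). -/
def coordHom (w : InfinitePlace L) : InfiniteAdeleRing L →+* ℂ :=
  (Pi.evalRingHom (fun _ : InfinitePlace L => ℂ) w).comp (piComplex L).toRingHom

/-- (Ported verbatim from the HodgeCMPerL package; no docstring in the source.) -/
@[simp] theorem coordHom_apply (w : InfinitePlace L) (x : InfiniteAdeleRing L) :
    coordHom L w x = piComplex L x w := rfl

/-- (Ported verbatim from the HodgeCMPerL package; no docstring in the source.) -/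
theorem continuous_coordHom (w : InfinitePlace L) : Continuous (coordHom L w) :=
  (continuous_apply w).comp (continuous_piComplex L)

/-- (Ported verbatim from the HodgeCMPerL package; no docstring in the source.) -/
theorem coordHom_algebraMap (w : InfinitePlace L) (x : L) :
    coordHom L w (algebraMap L (InfiniteAdeleRing L) x) = w.embedding x :=
  piComplex_algebraMap L x w

end TotallyComplex

/-! ## §2 CM fields: complex conjugation is coordinatewise -/

section CM

variable (L : Type*) [Field L] [NumberField L] [IsCMField L]

/-- Every infinite place of a CM field is stable under the complex conjugation `c ∈ Gal(L/L⁺)`. -/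
theorem complexConj_smul_infinitePlace (w : InfinitePlace L) : (IsCMField.complexConj L) • w = w :=
  InfinitePlace.ext _ _ fun x => by
    rw [InfinitePlace.smul_apply, ← IsCMField.infinitePlace_complexConj L w ((IsCMField.complexConj L).symm x),
      AlgEquiv.apply_symm_apply]

/-- At one place: the Galois transport `c_w : L_w → L_{w'}` (`c • w = w'`, so `w' = w`) is complex
conjugation under the coordinate isomorphisms. -/
theorem extensionEmbedding_galInfiniteCompletionMap {w w' : InfinitePlace L}
    (h : (IsCMField.complexConj L) • w = w') (y : w.Completion) :
    extensionEmbedding w' (galInfiniteCompletionMap (IsCMField.complexConj L) h y) =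
      conj (extensionEmbedding w y) := by
  have hw : w = w' := by rw [← h, complexConj_smul_infinitePlace]
  subst hw
  have key : (fun y : w.Completion =>
      extensionEmbedding w (galInfiniteCompletionMap (IsCMField.complexConj L) h y)) =
      fun y => conj (extensionEmbedding w y) := by
    refine InfinitePlace.Completion.ext_of_coe w
      ((isometry_extensionEmbedding w).continuous.comp
        (continuous_galInfiniteCompletionMap (↥(maximalRealSubfield L)) (IsCMField.complexConj L) h))
      (Complex.continuous_conj.comp (isometry_extensionEmbedding w).continuous) fun x => ?_
    show extensionEmbedding w (galInfiniteCompletionMap (IsCMField.complexConj L) h (x : w.Completion)) =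
      conj (extensionEmbedding w (x : w.Completion))
    rw [galInfiniteCompletionMap_coe]
    change extensionEmbedding w ((WithAbs.toAbs w.1 (IsCMField.complexConj L x) : WithAbs w.1) : w.Completion) =
      conj (extensionEmbedding w ((WithAbs.toAbs w.1 x : WithAbs w.1) : w.Completion))
    rw [extensionEmbedding_coe, extensionEmbedding_coe]
    exact IsCMField.complexEmbedding_complexConj L w.embedding x
  exact congrFun key y

/-- **`c ⊗ id` on `L_∞` is coordinatewise complex conjugation on `ℂ^{places}`.** -/
theorem piComplex_complexConj_smul (x : InfiniteAdeleRing L) (w : InfinitePlace L) :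
    piComplex L ((IsCMField.complexConj L) • x) w = conj (piComplex L x w) := by
  rw [piComplex_apply, piComplex_apply, InfiniteAdeleRing.smul_apply,
    extensionEmbedding_galInfiniteCompletionMap L]
  -- it remains to move the place `c⁻¹ • w` back to `w`
  have hw : (IsCMField.complexConj L)⁻¹ • w = w :=
    InfinitePlace.inv_smul_eq_of_smul_eq (complexConj_smul_infinitePlace L w)
  exact congrArg conj (by rw [hw] : extensionEmbedding ((IsCMField.complexConj L)⁻¹ • w)
      (x ((IsCMField.complexConj L)⁻¹ • w)) = extensionEmbedding w (x w))

/-- The same, as an identity of families: `piComplex (c • x) = star (piComplex x)`. -/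
theorem piComplex_complexConj_smul_eq_star (x : InfiniteAdeleRing L) :
    piComplex L ((IsCMField.complexConj L) • x) = star (piComplex L x) :=
  funext fun w => piComplex_complexConj_smul L x w

/-- (Ported verbatim from the HodgeCMPerL package; no docstring in the source.) -/
theorem coordHom_complexConj_smul (w : InfinitePlace L) (x : InfiniteAdeleRing L) :
    coordHom L w ((IsCMField.complexConj L) • x) = conj (coordHom L w x) :=
  piComplex_complexConj_smul L x w

end CM

end HodgeCM.PerL34.InfiniteAdeleComplex

end
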